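import Summits.Ventures.QEC.Census.CertMitmK
import Summits.Ventures.QEC.Census.LP.LP144w5.Cert
import Summits.Ventures.QEC.Census.LP.LP144w5.MitmKZ01
import HarnessLib

/-!
# `LP144w5` — KERNEL meet-in-the-middle replay, side Z, file 2/2 (emitted by qec-type-07, 07.MITMK)

Generic lane `Census/CertMitmK.lean` over the certificate data `LP/LP144w5/Cert.lean`: side Z = Z-type operators,
syndromes by `cert.HX` (72 rows), `wmax = d − 1 = 5 = wa + wb = 3 + 2`. The table of all patterns of
weight `≤ 2` (1 part(s), kernel-built by `tabFindQ`, keys mixed at 72 bits) is self-checked (T1ᴿ,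
`tableTestR`) and every pattern of weight `≤ 3` is probed against it (T3ᴿ, `probeTestR`, packed level-1 chunks
`chunk1RF` of `Census/CertCheckBZFast.lean` = `CertChunks.chunk1R`); allow-list = (LP144w5.cert.sideZ.found.map Prod.fst). 1 theorem(s) here,
each ONE `decide +kernel` (tier KERNEL: axioms ⊆ {propext, Classical.choice, Quot.sound}), run one at a time
(`Elab.async false`); ≈ 45 s of kernel time predicted by the emitter's replica (HOME/census/type-07/mitmk_lib.py),
which also pre-computed every verdict below as `true`. The end of this file ASSEMBLES the side (first-order terms only).
Do not edit; re-emit (HOME/census/type-07/emit_mitmk.py).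
-/

set_option Elab.async false

namespace Summit.Ventures.QEC.Census.LP144w5

/-- (T3ᴿ) Probes with first qubit in `[80, 144)` (`43744` patterns of weight `1 … 3`) against table part 0 of side Z: no hit, or hit up to `0` / an allow-listed stabilizer word. -/
theorem pZ0_80 :
    chunk1RF (probeTestR (tabFindQ (posList 144 LP144w5.cert.HX) 72 2 0 144) (LP144w5.cert.sideZ.found.map Prod.fst)) (posList 144 LP144w5.cert.HX) 2 80 64 = true := by
  decide +kernel

/-- Side Z, table part 0: EVERY probe of weight `≤ 3` passes (T3ᴿ) — `Reaches` assembled from the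
4 packed chunk range(s) by `CertChunks.reaches_origin_of_chunk1` (the origin probe is the empty pattern:
`probeTestR _ _ 0 0` by `decide`). -/
theorem probesZ0 :
    Reaches (probeTestR (tabFindQ (posList 144 LP144w5.cert.HX) 72 2 0 144) (LP144w5.cert.sideZ.found.map Prod.fst)) (posList 144 LP144w5.cert.HX) 3 0 0 :=
  reaches_origin_of_chunk1 144 (by decide +kernel) (by rw [probeTestR, tabFindQ_zero]; rfl)
    (forall_lt_append (forall_lt_append (forall_lt_append (forall_lt_append (forall_lt_zero) (forall_of_chunk1RF rfl pZ0_0)) (forall_of_chunk1RF rfl pZ0_16)) (forall_of_chunk1RF rfl pZ0_38)) (forall_of_chunk1RF rfl pZ0_80))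

/-- **Side Z of `LP144w5`, tier KERNEL**: every Z-pattern of weight `≤ 2` is filed in a kernel-built table part
against which every probe of weight `≤ 3` passes (`DistCert.MitmKZ`; assembled by `reachesP_origin_of_chunk1` from
the T1ᴿ part theorems and the `probesZ·` statements; the empty pattern is covered by part 0 via
`tableTestR_tabFindQ_origin`). With `Census/CertMitmK.mitmK_lower_sound`: no Z-logical of weight `≤ 5`. -/
theorem mitmKZ : LP144w5.cert.MitmKZ (LP144w5.cert.sideZ.found.map Prod.fst) 3 2 :=
  reachesP_origin_of_chunk1 144 (by decide +kernel)
    (coverP_origin (tabFindQ (posList 144 LP144w5.cert.HX) 72 2 0 144) (tableTestR_tabFindQ_origin _ _ _ _ _ _) probesZ0)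
    (forall_lt_append (forall_lt_zero) (forall_coverP_of_chunk1RF tZ0 probesZ0))

end Summit.Ventures.QEC.Census.LP144w5
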